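import Summits.Ventures.CertifiedQuantumChemistry.Rows.HubbardHalfFilledHeisenbergSpinLimit
import Summits.Ventures.CertifiedQuantumChemistry.Rows.HeisenbergRingL14GroundEnergyBracket
import HarnessLib

/-!
# Ventures/CertifiedQuantumChemistry — Rows/HubbardRingL14StrongCouplingLimit.lean: the strong-coupling constant of
# the half-filled Hubbard 14-ring, `lim U·E₀(14;U) = 4E₀(Σ_{i∈ℤ/14} 𝐒_i·𝐒_{i+1}) − 14 ∈ [-39.054198134188152, -39.054198134188144]`
# (T-K0-14, bracket form)

HONEST FRAMING (verbatim): certified bounds for a stated model Hamiltonian in a stated basis; not a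
claim about the real molecule beyond that model.

Seat ref/typer (`pub-qchem-typer`, gen 22). THEOREMS ONLY (no `def`, no claim node, no row, no certificate),
zero compute, standard axioms; scores nothing, moves no `CERTIFIED.md` byte; names no threshold and registers nothing
(HOME/STRUCTURE.md §2.5.7: the (S) instance `n = 7` that (F1) quotes, with the kernel h-bracket of T-H14(α) inserted).
The `L = 14` member of the family T-K0-4 / 6 / 8 / 10 / 12 (`Rows/HubbardRingStrongCouplingLimit.lean`,
`Rows/HubbardRingL6StrongCouplingLimit.lean`, `Rows/HubbardRingL8L10StrongCouplingLimit.lean`,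
`Rows/HubbardRingL12StrongCouplingLimit.lean`): by `Rows/HubbardHalfFilledHeisenbergSpinLimit.lean` ((S):
`U · Model.energy (hubbardRingTV L 1 U) n n → 4·E₀(heisenbergHamiltonian 1 (ringGraph L) 1) − L`, every `L = 2n ≥ 3`)
the limit EXISTS and equals the explicit real number `c₁₄ := 4·E₀(heisenbergHamiltonian 1 (ringGraph 14) 1) − 14`
(`= −4 h(14)`, HOME/STRUCTURE.md §2.2.3 / §2.5.7 (F1)); by the kernel Collatz–Wielandt bracket of
`Rows/HeisenbergRingL14GroundEnergyBracket.lean` (`E₀ ∈ [-6.263549533547038, -6.263549533547036]`),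

  `c₁₄ ∈ [-39.054198134188152, -39.054198134188144]`   (width `8e-15`; `c₁₄ = −μ₁₄ = −39.05419813418814…`).

No exact algebraic form of `c₁₄` is given (none is needed).

References: Takahashi (1999) / Essler et al. (2005) App. 2.A through (S); Marshall (1955), Lieb–Mattis (1962) Thm 2,
Tasaki (2020) §2.4 Thm 2.3, Horn–Johnson (2013) Cor. 8.1.29 through the bracket file; Bonner–Fisher (1964) (finite even
rings and the Hulthén limit `E₀(N)/N → 1/4 − ln 2 = −0.443147…`; here `E₀(14)/14 ≈ −0.447396`). Typer `pub-qchem-typer`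
(gen 22), 0 core-h.
-/

noncomputable section

namespace Summit.Ventures.CertifiedQuantumChemistry

open Filter Topology
open Literature.MathematicalPhysics.QuantumLattice Literature.MathematicalPhysics.QuantumChemistry
open Summit.Ventures.CertifiedQuantumChemistry.Hamiltonians

/-- **T-K0-14 (limit).** `U · E_(7,7)(hubbardRingTV 14 1 U) → 4·E₀(Σ_{i∈ℤ/14} 𝐒_i·𝐒_{i+1}) − 14` as `U → ∞` along `ℚ`
((S) at `L = 14`, `n = 7`). -/
theorem tendsto_mul_energy_hubbardRingTV_fourteen :
    Tendsto (fun U : ℚ => (U : ℝ) * (hubbardRingTV 14 1 U).energy 7 7) atTop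
      (𝓝 (4 * (heisenbergHamiltonian 1 (ringGraph 14) 1).groundEnergy - 14)) := by
  exact_mod_cast tendsto_mul_energy_hubbardRingTV_halfFilled_groundEnergy_sub (L := 14) (n := 7) rfl (by norm_num)

/-- **T-K0-14 (bracket of the constant).** `4·E₀(Σ_{i∈ℤ/14} 𝐒_i·𝐒_{i+1}) − 14 ∈ [-39.054198134188152, -39.054198134188144]`
(`= −4 h(14)`, `h(14) ∈ [9.763549533547036, 9.763549533547038]`). -/
theorem strongCouplingConstant_fourteen_mem_Icc :
    4 * (heisenbergHamiltonian 1 (ringGraph 14) 1).groundEnergy - 14 ∈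
      Set.Icc (-(39054198134188152 / 10 ^ 15 : ℝ)) (-(39054198134188144 / 10 ^ 15)) := by
  obtain ⟨hlo, hhi⟩ := HeisenbergRing14.groundEnergy_mem_Icc
  constructor <;> linarith

/-- **T-K0-14, packaged.** There is `c ∈ [-39.054198134188152, -39.054198134188144]` with
`U · E_(7,7)(hubbardRingTV 14 1 U) → c` (`U → ∞` along `ℚ`); i.e. `lim U·E₀(14;U) = −4 h(14) = −39.05419813418814…`. -/
theorem tendsto_mul_energy_hubbardRingTV_fourteen_mem_Icc :
    ∃ c : ℝ, c ∈ Set.Icc (-(39054198134188152 / 10 ^ 15 : ℝ)) (-(39054198134188144 / 10 ^ 15)) ∧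
      Tendsto (fun U : ℚ => (U : ℝ) * (hubbardRingTV 14 1 U).energy 7 7) atTop (𝓝 c) :=
  ⟨_, strongCouplingConstant_fourteen_mem_Icc, tendsto_mul_energy_hubbardRingTV_fourteen⟩

/-- The same limit in the `S_z`-sector (`minEnergyOn (szSector 14 0)`) spelling of T-K0-4. -/
theorem tendsto_mul_minEnergyOn_szSector_hubbardRingTV_fourteen :
    Tendsto (fun U : ℚ => (U : ℝ) * ((hubbardRingTV 14 1 U).hamiltonian.minEnergyOn (szSector 14 0))) atTop
      (𝓝 (4 * (heisenbergHamiltonian 1 (ringGraph 14) 1).groundEnergy - 14)) := by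
  refine tendsto_mul_energy_hubbardRingTV_fourteen.congr fun U => ?_
  rw [Model.energy, sectorGroundEnergy_def, sub_self, zero_div]

end Summit.Ventures.CertifiedQuantumChemistry

end
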